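import Literature.NumberTheory.EllipticCurves.ModularityVersionAp
import Literature.NumberTheory.EllipticCurves.Gamma1NewformLSeriesProofs
import HarnessLib

/-!
# The Euler product of a newform on `Γ₀(N)` — discharge of `IsNewform0.hasProd_cuspFormLSeries`

Topic `Literature/NumberTheory/EllipticCurves`; theorems only (no definition, no named fact).
`CuspFormLFunction.lean` states as a named fact (D-0014)

  `IsNewform0.hasProd_cuspFormLSeries : ∀ {f : S_k(Γ₀(N))}, IsNewform0 f → ∀ {s}, k/2 + 1 < re s →`
  `  HasProd (p ↦ (1 - a_p(f) p^{-s} + 𝟙_N(p) p^{k-1-2s})⁻¹) (L(f, s))`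

(Diamond–Shurman, *A First Course in Modular Forms*, Thm. 5.9.2: "`L(s, f)` has an Euler product
expansion `L(s, f) = ∏_p (1 − a_p p^{-s} + 𝟙_N(p) p^{k−1−2s})⁻¹`" for a normalised eigenform
`f ∈ M_k(N, 𝟙_N)`, the product converging for `re s > k/2 + 1`; Atkin–Lehner 1970, Thm. 3).
The `Γ₁(N)` twin `IsNewform1.hasProd_cuspFormLSeries` is discharged in
`Gamma1NewformLSeriesProofs`; this file discharges the `Γ₀(N)` fact the same way, following the
printed proof (Diamond–Shurman (5.24)–(5.26)): `a₁ = 1`, multiplicativity on coprime arguments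
(Prop. 5.8.5 (3): the tree's `IsNewform0.coeff_mul_of_coprime_holds`, `ModularityVersionAp`),
the prime-power recursion `a_{p^{r+2}} = a_p a_{p^{r+1}} − 𝟙_N(p) p^{k−1} a_{p^r}` (Prop. 5.8.5
(2), from `IsNewform0.cuspCoeff_prime_mul`; here `IsNewform0.cuspCoeff_prime_pow_add_two_weight`,
any weight), absolute convergence for `re s > k/2 + 1` (`LSeriesSummable_cuspCoeff_gamma0`,
§5.9), and the generic Euler product for such Dirichlet series
(`Literature.NumberTheory.Automorphic.LSeries_hasProd_of_recurrence`, Mathlib's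
`EulerProduct.eulerProduct_hasProd` with the local factor `(∑ c_r x^r)(1 − a x + b x²) = 1`).

## References

* F. Diamond, J. Shurman, *A First Course in Modular Forms*, GTM 228 (2005), Prop. 5.8.5,
  Thm. 5.9.2 and its proof, (5.24)–(5.26). [DiamondShurman2005]
* A. O. L. Atkin, J. Lehner, *Hecke operators on `Γ₀(m)`*, Math. Ann. 185 (1970), Thm. 3.
  [AtkinLehner1970]
-/

noncomputable section

open scoped MatrixGroups ModularForm

open CongruenceSubgroup Complex

namespace Literature.NumberTheory.EllipticCurves.ModularForms

variable {N : ℕ} [NeZero N] {k : ℤ}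

/-- **Prime-power recursion for newform coefficients, any weight** (Diamond–Shurman Prop. 5.8.5
(2) with `χ = 𝟙_N`): `a_{p^{e+2}} = a_p a_{p^{e+1}} − 𝟙_N(p) p^{k−1} a_{p^e}` for a newform
`f ∈ S_k(Γ₀(N))` and a prime `p` (from `IsNewform0.cuspCoeff_prime_mul`; the weight-`2` case is
`IsNewform0.cuspCoeff_prime_pow_add_two`). [cite: DiamondShurman2005, Prop. 5.8.5] -/
theorem IsNewform0.cuspCoeff_prime_pow_add_two_weight {f : CuspForm (Gamma0 N) k}
    (hf : IsNewform0 f) {p : ℕ} (hp : p.Prime) (e : ℕ) :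
    cuspCoeff f (p ^ (e + 2)) = cuspCoeff f p * cuspCoeff f (p ^ (e + 1)) -
      (if p ∣ N then 0 else (p : ℂ) ^ (k - 1)) * cuspCoeff f (p ^ e) := by
  have h := hf.cuspCoeff_prime_mul hp (p ^ (e + 1))
  have hdiv : p ^ (e + 1) / p = p ^ e := by rw [pow_succ, Nat.mul_div_cancel _ hp.pos]
  rw [← pow_succ', if_pos (dvd_pow_self p (Nat.succ_ne_zero e)), hdiv] at h
  rw [h]
  split_ifs <;> ring

/-- **Discharge of `IsNewform0.hasProd_cuspFormLSeries`** (Diamond–Shurman Thm. 5.9.2;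
Atkin–Lehner 1970, Thm. 3): for a newform `f = Σ aₙ qⁿ ∈ S_k(Γ₀(N))` and `re s > k/2 + 1`,
`L(f, s) = ∏_p (1 − a_p p^{-s} + 𝟙_N(p) p^{k−1−2s})⁻¹`, the product over the primes converging
(`HasProd` over `Nat.Primes`). Proof as printed ((5.24)–(5.26)): the generic Euler product
`Literature.NumberTheory.Automorphic.LSeries_hasProd_of_recurrence` fed with `a₁ = 1`,
`IsNewform0.coeff_mul_of_coprime_holds`, `IsNewform0.cuspCoeff_prime_pow_add_two_weight`
(`e_p = 𝟙_N(p) p^{k−1}`) and `LSeriesSummable_cuspCoeff_gamma0`, followed by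
`p^{k−1} (p^{-s})² = p^{k−1−2s}`. [cite: DiamondShurman2005, Thm. 5.9.2 and its proof] -/
theorem IsNewform0.hasProd_cuspFormLSeries_holds :
    IsNewform0.hasProd_cuspFormLSeries (N := N) (k := k) := by
  intro f hf s hs
  have h := Automorphic.LSeries_hasProd_of_recurrence (a := cuspCoeff f)
    (e := fun p ↦ if p ∣ N then 0 else (p : ℂ) ^ (k - 1))
    (show cuspCoeff f 1 = 1 from hf.2.2) (IsNewform0.coeff_mul_of_coprime_holds hf)
    (fun hp r ↦ hf.cuspCoeff_prime_pow_add_two_weight hp r)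
    (LSeriesSummable_cuspCoeff_gamma0 f hs)
  refine h.congr_fun fun p ↦ ?_
  by_cases hpN : (p : ℕ) ∣ N
  · simp only [if_pos hpN, zero_mul]
  · simp only [if_neg hpN]
    rw [cpow_intCast_sub_one_sub_two_mul (Nat.cast_ne_zero.mpr p.2.ne_zero)]

end Literature.NumberTheory.EllipticCurves.ModularForms

end
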